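import Literature.MathematicalPhysics.QuantumFieldTheory.Balaban1983to89.NodeOLettersOfWalksPerturbative
import Literature.MathematicalPhysics.QuantumFieldTheory.Balaban1983to89.NodeOLettersOfWalksWitness

/-!
# `Balaban1983to89.NodeOLettersOfWalksPerturbativeWitness` — NON-VACUITY of the reference rung `TermWalksRef` TOGETHER WITH the two
# margins of `termWalks_of_ref`: a one-site mass term far from a one-point σ-region (degenerate MODEL; volume-uniform constants)

statement-level bookkeeping over published theorems with citation tags; kernel-checked compositions of tree theorems; nothing here is a
claim about the Yang–Mills mass gap.

Cell `pub-ymgap`, D-0062 Track A, node N10 = [Balaban1988RG2Cluster] Lemmas 1–3; seat `dag-n10-b` g6.  WHY.  `NodeOLettersOfWalksPerturbative`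
(p454417) replaces the W-walks rung's two complex-background accretivities and five volume sums by REFERENCE data (`TermWalksRef`) plus two
MARGINS (`termWalks_of_ref`, threshold form `termWalks_of_ref_thresholds`).  The margins read the far-ness `R_σ` and the accretivity radius
`R₁` against the SAME constants the datum carries, so their joint satisfiability with the datum is not automatic from the inhabitation of
`TermWalks` (the tree's models `NodeOLettersOfWalksWitness(Sym)`, `…AcrossWitness` sit at `R_σ = 0`).  THIS FILE inhabits
`TermWalksRef` AND the four thresholds at once by the simplest geometry in which far-ness is genuine: ONE site `y₀` (row = column location),
σ-region `X = {x₀}` at torus distance `≥ R_σ`, the σ- and `u`-independent kernels `A2 = μ·1`, `P = μ·1`, `L ≡ 1` (so `G2 = L·P^{−1/2}`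
by definition — the (2.7) reading), reference data proved real ∕ positive definite.  The package is `(R; ε, κ, 1; ε, κ, μ; μ; ε, κ, μ; μ;
η; R_σ; n_B = 1; d_m)` — VOLUME-UNIFORM (no torus size enters); the thresholds hold as soon as `8c₀(1,κ/2)^{d_m}e^{−εR_σ} ≤ 1`,
`8c₀(1,η)^{d_m}e^{−εR_σ} ≤ 1`, `8c₀(1,κ/2)^{d_m}R₁ ≤ R`, `8c₀(1,η)^{d_m}R₁ ≤ R` — `R_σ` LARGE, `R₁` SMALL, exactly the order of choices of
`NodeOLettersOfWalksPerturbative` §6.  Degenerate (printed case *"m = 0"* of (1.11) for every term); says nothing about Bałaban's kernels.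
* §1 [folklore] helpers: one-member `MajSumLe`, the form of `μ·1`, realness of `invSqrt` of a real scalar matrix, fibres of a constant map.
* §2 `oneSiteTerm` (the MODEL `TermKernels` record; `hG0`, `hC0`, `hC` proved), `oneSitePackage`, `admissible_oneSitePackage`,
  **`termWalksRef_oneSite`** (the reference datum, far-ness `R_σ ≤ d₁(y₀,x₀)` as the only geometric input),
  **`termWalks_oneSite`** (the rung's datum from it under the four thresholds, by `termWalks_of_ref_thresholds`).
* §3 `oneSiteFamily` (members = tori of dimension `≤ d_m` with their site pairs), **`uniformWalksAcrossRef_oneSiteFamily`**,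
  **`uniformWalksAcross_oneSiteFamily`** — the reference rung and the rung ACROSS THE FAMILY WITH ONE PACKAGE (no torus size enters).

CITATIONS.  [Balaban1988RG2Cluster] (1.11) p. 5 (*"m is the number of the parameters s connected with the walk ω"* — here `m = 0`),
(2.7) p. 13, p. 15, (2.16) p. 16; [Balaban1985BackgroundPropagators] Thm 3.10 p. 416; [Balaban1984PropagatorsII] Lemma 2.1 (2.61) p. 234.

HONEST FRAMING: a degenerate finite-matrix MODEL inhabiting a hypothesis shape; NOTHING of Bałaban's operators; count-neutral Track-A side
landing; NOT a discharge of N10; NOT NODE O for his family; nothing continuum ∕ ℝ⁴ ∕ OS ∕ mass-gap ∕ Clay.  0 `sorry`; `abbrev`∕`def` =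
model data, no instance beyond the record's bundled ones, no notation; standard axioms.
-/

noncomputable section

namespace Literature.MathematicalPhysics.QuantumFieldTheory.Balaban1983to89.NodeOLettersOfWalksPerturbativeWitness

open Metric Set Finset
open scoped Matrix
open Literature.MathematicalPhysics.QuantumFieldTheory.Balaban1983to89
open Literature.MathematicalPhysics.QuantumFieldTheory.Balaban1983to89.B9SectDWalk (MajSumLe)
open Literature.MathematicalPhysics.QuantumFieldTheory.Balaban1983to89.B9Thm34Ext (toB6)
open Literature.MathematicalPhysics.QuantumFieldTheory.Balaban1983to89.B9Thm37GlueTorus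
  (torusGeom tdist1 tdist1_nonneg tdist1_self tdist1_comm)
open Literature.MathematicalPhysics.QuantumFieldTheory.Balaban1983to89.TreeLengthTorus (TPt)
open Literature.MathematicalPhysics.QuantumFieldTheory.Balaban1983to89.B5TorusCover (UT)
open Literature.MathematicalPhysics.QuantumFieldTheory.Balaban1983to89.B13JointWalkExpansion
  (JointWalkExpansion jointWalkExpansion_const)
open Literature.MathematicalPhysics.QuantumFieldTheory.Balaban1983to89.B13TermWalkData (TermKernels)
open Literature.MathematicalPhysics.QuantumFieldTheory.Balaban1983to89.NodeOLettersOfWalksAcross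
  (WalkPackage TermWalks UniformWalksAcross)
open Literature.MathematicalPhysics.QuantumFieldTheory.Balaban1983to89.NodeOLettersOfWalksPerturbative
  (RefPackage TermWalksRef UniformWalksAcrossRef termWalks_of_ref_thresholds uniformWalksAcross_of_ref margin_of_thresholds)
open Literature.MathematicalPhysics.QuantumFieldTheory.Balaban1983to89.NodeOLettersOfWalksWitness
  (jointWalkExpansion_mass im_invSqrt_map_ofReal)
open Literature.MathematicalPhysics.QuantumFieldTheory.Balaban1983to89.B13Sqrt27Accretive (invSqrt)

variable {d N' : ℕ} {ν : ℕ} {Nf : Fin ν → ℕ} [∀ i, NeZero (Nf i)]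
variable {E : Type*} [NormedAddCommGroup E] [NormedSpace ℂ E]

/-! ## §1. Helpers -/

/-- A one-member majorant family on `Unit`: partial sums are bounded by the member (non-negative). [folklore] -/
private theorem majSumLe_unit {g : B6.Geometry} {K Kbar : g.Site → g.Site → ℝ} (hK : ∀ a b, 0 ≤ K a b)
    (hle : ∀ a b, K a b ≤ Kbar a b) : MajSumLe (fun (_ : Unit) a b => K a b) Kbar := by
  intro S a b
  calc ∑ _ω ∈ S, K a b ≤ ∑ _ω ∈ (Finset.univ : Finset Unit), K a b :=
        Finset.sum_le_sum_of_subset_of_nonneg (Finset.subset_univ S) fun _ _ _ => hK a b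
    _ = K a b := by simp
    _ ≤ Kbar a b := hle a b

/-- The form of the scalar matrix `μ·1`: `Re Σ conj(v_i)((μ·1)v)_i = μ·Σ|v_i|²`. [folklore] -/
private theorem re_form_smul_one {ι : Type} [Fintype ι] [DecidableEq ι] (μ : ℝ) (v : ι → ℂ) :
    (∑ i, star (v i) * (((μ : ℂ) • (1 : Matrix ι ι ℂ)) *ᵥ v) i).re = μ * ∑ i, ‖v i‖ ^ 2 := by
  rw [Matrix.smul_mulVec, Matrix.one_mulVec, Complex.re_sum, Finset.mul_sum]
  refine Finset.sum_congr rfl fun i _ => ?_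
  rw [Pi.smul_apply, smul_eq_mul, Complex.star_def, mul_left_comm, Complex.conj_mul', ← Complex.ofReal_pow,
    ← Complex.ofReal_mul, Complex.ofReal_re]

/-- The scalar matrix `μ·1` over `ℂ` is the complexification of the real one. [folklore] -/
private theorem smul_one_eq_map {ι : Type} [DecidableEq ι] (μ : ℝ) :
    ((μ : ℂ) • (1 : Matrix ι ι ℂ)) = (μ • (1 : Matrix ι ι ℝ)).map (algebraMap ℝ ℂ) := by
  ext i j
  by_cases h : i = j
  · subst h; simp
  · simp [Matrix.one_apply_ne h]

/-- A complex matrix with vanishing imaginary parts is the complexification of its real part. [folklore] -/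
private theorem eq_map_re_of_im {p n : Type} {M : Matrix p n ℂ} (h : ∀ i j, (M i j).im = 0) :
    M = (M.map Complex.re).map (algebraMap ℝ ℂ) := by
  ext i j
  apply Complex.ext
  · simp
  · simp [h i j]

omit [∀ i, NeZero (Nf i)] in
/-- A constant location map on a one-element index type has fibres of size `≤ 1`. [folklore] -/
private theorem fibre_const_le_one {ι : Type} [Fintype ι] [Subsingleton ι] (y₀ x : UT Nf) :
    (Finset.univ.filter fun _ : ι => y₀ = x).card ≤ 1 :=
  (Finset.card_filter_le _ _).trans (Finset.card_le_one_iff_subsingleton_coe.2 inferInstance)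

/-! ## §2. The one-site model and its reference datum -/

section Model

variable (Nf)

/-- MODEL. **THE ONE-SITE TERM**: one row bond and one column variable, both located at `y₀` (`Λ = Unit`, `C₀ = Fin 0`), σ-region
`X = {x₀}`; term precision `A2 = μ·1`, full precision `P = μ·1`, local factor `L ≡ 1`, Γ-kernel `G2 = L·P^{−1/2}` (the (2.7) reading, by
definition); reference data `Γ₀ = Re G2(0,0)` (real: `invSqrt` of a real matrix is real), `C = diag(μ⁻¹) ≻ 0`; all σ- and `u`-INDEPENDENT
(print's case *"m = 0"* for every term).  Degenerate; nothing of Bałaban's. [cite: Balaban1988RG2Cluster, (1.11) p.5, (2.7) p.13, p.15] -/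
abbrev oneSiteTerm (c : B13.Consts) (y₀ x₀ : UT Nf) {μ : ℝ} (hμ : 0 < μ) : TermKernels c d N' ν Nf E where
  Λ := Unit
  C₀ := Fin 0
  A2 := fun _ _ => (μ : ℂ) • (1 : Matrix Unit Unit ℂ)
  G2 := fun _ _ => Matrix.of (fun (_ : Unit) (_ : Unit ⊕ Fin 0) => (1 : ℂ)) *
    invSqrt ((μ : ℂ) • (1 : Matrix (Unit ⊕ Fin 0) (Unit ⊕ Fin 0) ℂ))
  Γ₀ := (Matrix.of (fun (_ : Unit) (_ : Unit ⊕ Fin 0) => (1 : ℂ)) *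
    invSqrt ((μ : ℂ) • (1 : Matrix (Unit ⊕ Fin 0) (Unit ⊕ Fin 0) ℂ))).map Complex.re
  C := Matrix.diagonal fun _ => μ⁻¹
  locΛ := fun _ => y₀
  locN := fun _ => y₀
  X := {x₀}
  m := 1
  hfib := fun x => fibre_const_le_one y₀ x
  hG0 := eq_map_re_of_im fun i j => by
    rw [Matrix.mul_apply, Complex.im_sum]
    refine Finset.sum_eq_zero fun k _ => ?_
    rw [Matrix.of_apply, one_mul, smul_one_eq_map, im_invSqrt_map_ofReal]
  hC0 := by
    have hμ0 : (μ : ℂ) ≠ 0 := Complex.ofReal_ne_zero.2 hμ.ne'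
    apply Matrix.inv_eq_right_inv
    rw [smul_mul_assoc, Matrix.one_mul, Matrix.diagonal_map (map_zero _)]
    ext i j
    rw [Subsingleton.elim i j]
    simp [hμ0]
  hC := Matrix.posDef_diagonal_iff.2 fun _ => inv_pos.2 hμ

variable {Nf}

/-- **THE ONE-SITE REFERENCE PACKAGE** `(R; ε, κ, 1; ε, κ, μ; m₀ = μ; ε, κ, μ; m_{A,0} = μ; η; R_σ; n_B = 1; d_m)` — NO torus size.
[cite: Balaban1988RG2Cluster, (1.11) p.5, p.15] -/
def oneSitePackage (μ R ε κ η Rσ : ℝ) (dm : ℕ) : RefPackage where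
  R := R
  εL := ε
  kapL := κ
  KbarL := 1
  εP := ε
  kapP := κ
  KbarP := μ
  m₀ := μ
  εA := ε
  kapA := κ
  KbarA := μ
  mA₀ := μ
  η := η
  Rσ := Rσ
  nB := 1
  dm := dm

/-- The one-site package is admissible for `μ, R, κ, η > 0`, `ε ≥ 0`, `η ≤ κ`. [cite: Balaban1988RG2Cluster, p.15] -/
theorem admissible_oneSitePackage {μ R ε κ η Rσ : ℝ} {dm : ℕ} (hμ : 0 < μ) (hR : 0 < R) (hε : 0 ≤ ε) (hκ : 0 < κ)
    (hη : 0 < η) (hηκ : η ≤ κ) : (oneSitePackage μ R ε κ η Rσ dm).Admissible where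
  hR := hR
  hεL := hε
  hkapL := hκ.le
  hKbarL := zero_le_one
  hεP := hε
  hkapP := hκ
  hKbarP := hμ.le
  hm₀ := hμ
  hεA := hε
  hkapA := hκ
  hKbarA := hμ.le
  hmA₀ := hμ
  hη := hη
  hηA := hηκ

/-- **THE REFERENCE DATUM IS INHABITED, WITH GENUINE FAR-NESS**: for every torus, sites `y₀, x₀` at torus distance `≥ R_σ`, `μ > 0`,
any `R, ε, κ, η` and `ν ≤ d_m`, the one-site term carries `TermWalksRef` with the one-site package: the three expansions are the
one-walk expansions of constant kernels (`jointWalkExpansion_mass`, `jointWalkExpansion_const`; walk rate `κ + ε`, empty σ-carrying family),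
the two reference accretivities are `Re⟨v, μv⟩ = μ|v|²`, far ∕ farN are the hypothesis `R_σ ≤ d₁(y₀,x₀)`, multiplicities `1`.
[cite: Balaban1988RG2Cluster, (1.11) p.5, (2.7) p.13, p.15; Balaban1985BackgroundPropagators, Thm 3.10 p.416] -/
theorem termWalksRef_oneSite (c : B13.Consts) {y₀ x₀ : UT Nf} {μ R ε κ η Rσ : ℝ} {dm : ℕ} (hμ : 0 < μ)
    (hfar : Rσ ≤ tdist1 Nf y₀ x₀) (hν : ν ≤ dm) :
    TermWalksRef (oneSiteTerm (d := d) (N' := N') (E := E) Nf c y₀ x₀ hμ) (oneSitePackage μ R ε κ η Rσ dm) := by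
  have hwin : κ ≤ (κ + ε) - ε := by linarith
  -- the local factor `L ≡ 1`: a one-walk expansion of a constant kernel with amplitude `1`
  have hL : JointWalkExpansion c (fun _ : Unit => y₀) (fun _ : Unit ⊕ Fin 0 => y₀)
      (fun (_ : TPt d N' → ℂ) (_ : E) => Matrix.of (fun (_ : Unit) (_ : Unit ⊕ Fin 0) => (1 : ℂ))) {x₀} R ε κ 1
      (fun (_ : Unit) (_ : TPt d N' → ℂ) (_ : E) => Matrix.of (fun (_ : Unit) (_ : Unit ⊕ Fin 0) => (1 : ℂ))) (∅ : Set Unit)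
      (fun _ => 1) (fun _ => tdist1 Nf) (κ + ε) := by
    refine jointWalkExpansion_const c _ _ _ {x₀} zero_le_one (fun a b => tdist1_nonneg a b) (fun i j => ?_) ?_
    · simp [tdist1_self]
    · refine majSumLe_unit (fun a b => by positivity) (fun a b => ?_)
      rw [show κ + ε - ε = κ by ring]
  refine
    { nonempty := ⟨x₀, Finset.mem_singleton_self x₀⟩
      product := ⟨fun _ _ => Matrix.of (fun (_ : Unit) (_ : Unit ⊕ Fin 0) => (1 : ℂ)),
        fun _ _ => (μ : ℂ) • (1 : Matrix (Unit ⊕ Fin 0) (Unit ⊕ Fin 0) ℂ), fun _ _ => rfl,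
        ⟨Unit, _, ∅, _, _, κ + ε, hL⟩,
        ⟨Unit, _, ∅, _, _, κ + ε, jointWalkExpansion_mass c (fun _ : Unit ⊕ Fin 0 => y₀) {x₀} hμ.le hwin⟩,
        fun v => (re_form_smul_one μ v).symm.le⟩
      precision := ⟨Unit, _, ∅, _, _, κ + ε, jointWalkExpansion_mass c (fun _ : Unit => y₀) {x₀} hμ.le hwin⟩
      refAccA := fun v => (re_form_smul_one μ v).symm.le
      far := fun _ z hz => by rw [Finset.mem_singleton.1 hz]; exact hfar
      farN := fun _ z hz => by rw [Finset.mem_singleton.1 hz]; exact hfar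
      multΛ := fun x => fibre_const_le_one y₀ x
      multN := fun x => (Finset.card_filter_le _ _).trans (by simp [oneSitePackage])
      dim := hν }

/-- **THE RUNG'S DATUM FROM IT, UNDER THE FOUR THRESHOLDS** — joint satisfiability of `TermWalksRef` with the margins of
`termWalks_of_ref`: far-ness `R_σ` LARGE (`8c₀(1,κ/2)^{d_m}e^{−εR_σ} ≤ 1`, `8c₀(1,η)^{d_m}e^{−εR_σ} ≤ 1`) and accretivity radius `R₁` SMALL
(`8c₀(1,κ/2)^{d_m}R₁ ≤ R`, `8c₀(1,η)^{d_m}R₁ ≤ R`, `0 < R₁ < R`) give `TermWalks` for the one-site term with the package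
`(oneSitePackage …).toWalkPackage R₁` — on every torus admitting two sites at distance `≥ R_σ`, constants volume-uniform.
[cite: Balaban1988RG2Cluster, (1.11) p.5, (2.7) p.13, p.15, (2.16) p.16; Balaban1985BackgroundPropagators, Thm 3.10 p.416] -/
theorem termWalks_oneSite (c : B13.Consts) {y₀ x₀ : UT Nf} {μ R ε κ η Rσ R₁ : ℝ} {dm : ℕ} (hμ : 0 < μ) (hR : 0 < R)
    (hε : 0 ≤ ε) (hκ : 0 < κ) (hη : 0 < η) (hηκ : η ≤ κ) (hfar : Rσ ≤ tdist1 Nf y₀ x₀) (hν : ν ≤ dm)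
    (hR₁ : 0 < R₁) (hR₁R : R₁ < R)
    (hσ₀ : 8 * B6.c0 1 (κ / 2) ^ dm * Real.exp (-(ε * Rσ)) ≤ 1) (h₁₀ : 8 * B6.c0 1 (κ / 2) ^ dm * R₁ ≤ R)
    (hσ : 8 * B6.c0 1 η ^ dm * Real.exp (-(ε * Rσ)) ≤ 1) (h₁ : 8 * B6.c0 1 η ^ dm * R₁ ≤ R) :
    TermWalks (oneSiteTerm (d := d) (N' := N') (E := E) Nf c y₀ x₀ hμ) ((oneSitePackage μ R ε κ η Rσ dm).toWalkPackage R₁) := by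
  refine termWalks_of_ref_thresholds (admissible_oneSitePackage hμ hR hε hκ hη hηκ)
    (termWalksRef_oneSite c hμ hfar hν) hR₁ hR₁R ?_ ?_ ?_ ?_
  · show 8 * μ * ((1 : ℕ) * B6.c0 1 (κ / 2) ^ dm) * Real.exp (-(ε * Rσ)) ≤ μ
    rw [Nat.cast_one, one_mul]; nlinarith [Real.exp_pos (-(ε * Rσ))]
  · show 8 * μ * ((1 : ℕ) * B6.c0 1 (κ / 2) ^ dm) * R₁ ≤ μ * R
    rw [Nat.cast_one, one_mul]; nlinarith
  · show 8 * μ * ((1 : ℕ) * B6.c0 1 η ^ dm) * Real.exp (-(ε * Rσ)) ≤ μ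
    rw [Nat.cast_one, one_mul]; nlinarith [Real.exp_pos (-(ε * Rσ))]
  · show 8 * μ * ((1 : ℕ) * B6.c0 1 η ^ dm) * R₁ ≤ μ * R
    rw [Nat.cast_one, one_mul]; nlinarith

end Model

/-! ## §3. Across a family of tori with ONE package -/

section Family

/-- MODEL. **THE ONE-SITE FAMILY ACROSS TORI**: member `s` = a torus `UT (Nf s)` (dimension `ν s`) with its pair of sites `y₀ s, x₀ s`,
ONE one-site term each, common `μ`, common configuration space `E₀`. [cite: Balaban1988RG2Cluster, (1.11) p.5, p.13] -/
abbrev oneSiteFamily (c : B13.Consts) (N' : ℕ) (E₀ : Type) [NormedAddCommGroup E₀] [NormedSpace ℂ E₀] {S : Type*} (νs : S → ℕ)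
    (Nfs : (s : S) → Fin (νs s) → ℕ) [hne : ∀ s i, NeZero (Nfs s i)] (y₀ x₀ : (s : S) → UT (Nfs s)) {μ : ℝ} (hμ : 0 < μ) :
    S → B13TermWalkData.TorusTerms c d := fun s =>
  { N' := N', ν := νs s, Nf := Nfs s, E := E₀, ι := Unit, 𝒦 := fun _ => oneSiteTerm (d := d) (N' := N') (E := E₀) (Nfs s) c (y₀ s) (x₀ s) hμ }

/-- **`UniformWalksAcrossRef` FOR THE ONE-SITE FAMILY WITH ONE PACKAGE**: far-ness `R_σ ≤ d₁(y₀ s, x₀ s)` on every member and a common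
dimension bound `ν s ≤ d_m` are the only inputs; NO torus size enters the package. [cite: Balaban1988RG2Cluster, (1.11) p.5, p.13, p.15] -/
theorem uniformWalksAcrossRef_oneSiteFamily (c : B13.Consts) (N' : ℕ) (E₀ : Type) [NormedAddCommGroup E₀] [NormedSpace ℂ E₀]
    {S : Type*} {νs : S → ℕ} {Nfs : (s : S) → Fin (νs s) → ℕ} [hne : ∀ s i, NeZero (Nfs s i)] {y₀ x₀ : (s : S) → UT (Nfs s)}
    {μ R ε κ η Rσ : ℝ} {dm : ℕ} (hμ : 0 < μ) (hfar : ∀ s, Rσ ≤ tdist1 (Nfs s) (y₀ s) (x₀ s)) (hν : ∀ s, νs s ≤ dm) :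
    UniformWalksAcrossRef (oneSiteFamily (d := d) c N' E₀ νs Nfs y₀ x₀ hμ) (oneSitePackage μ R ε κ η Rσ dm) :=
  fun s _ => ⟨inferInstance, inferInstance, termWalksRef_oneSite c hμ (hfar s) (hν s)⟩

/-- **THE RUNG `UniformWalksAcross` FOR THE ONE-SITE FAMILY WITH ONE PACKAGE** under the four thresholds (`R_σ` large, `R₁` small) —
`uniformWalksAcross_of_ref` ∘ `margin_of_thresholds`; hence NODE O's binder for this family by `acrossSmall_of_walks(_std)` as for any
inhabitant of the rung.  Degenerate model; nothing of Bałaban's. [cite: Balaban1988RG2Cluster, (1.11) p.5, p.13, p.15, (2.16) p.16] -/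
theorem uniformWalksAcross_oneSiteFamily (c : B13.Consts) (N' : ℕ) (E₀ : Type) [NormedAddCommGroup E₀] [NormedSpace ℂ E₀]
    {S : Type*} {νs : S → ℕ} {Nfs : (s : S) → Fin (νs s) → ℕ} [hne : ∀ s i, NeZero (Nfs s i)] {y₀ x₀ : (s : S) → UT (Nfs s)}
    {μ R ε κ η Rσ R₁ : ℝ} {dm : ℕ} (hμ : 0 < μ) (hR : 0 < R) (hε : 0 ≤ ε) (hκ : 0 < κ) (hη : 0 < η) (hηκ : η ≤ κ)
    (hfar : ∀ s, Rσ ≤ tdist1 (Nfs s) (y₀ s) (x₀ s)) (hν : ∀ s, νs s ≤ dm) (hR₁ : 0 < R₁) (hR₁R : R₁ < R)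
    (hσ₀ : 8 * B6.c0 1 (κ / 2) ^ dm * Real.exp (-(ε * Rσ)) ≤ 1) (h₁₀ : 8 * B6.c0 1 (κ / 2) ^ dm * R₁ ≤ R)
    (hσ : 8 * B6.c0 1 η ^ dm * Real.exp (-(ε * Rσ)) ≤ 1) (h₁ : 8 * B6.c0 1 η ^ dm * R₁ ≤ R) :
    UniformWalksAcross (oneSiteFamily (d := d) c N' E₀ νs Nfs y₀ x₀ hμ) ((oneSitePackage μ R ε κ η Rσ dm).toWalkPackage R₁) := by
  refine uniformWalksAcross_of_ref (admissible_oneSitePackage hμ hR hε hκ hη hηκ)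
    (uniformWalksAcrossRef_oneSiteFamily (d := d) c N' E₀ hμ hfar hν) hR₁ hR₁R (margin_of_thresholds hR ?_ ?_) (margin_of_thresholds hR ?_ ?_)
  · show 8 * μ * ((1 : ℕ) * B6.c0 1 (κ / 2) ^ dm) * Real.exp (-(ε * Rσ)) ≤ μ
    rw [Nat.cast_one, one_mul]; nlinarith [Real.exp_pos (-(ε * Rσ))]
  · show 8 * μ * ((1 : ℕ) * B6.c0 1 (κ / 2) ^ dm) * R₁ ≤ μ * R
    rw [Nat.cast_one, one_mul]; nlinarith
  · show 8 * μ * ((1 : ℕ) * B6.c0 1 η ^ dm) * Real.exp (-(ε * Rσ)) ≤ μ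
    rw [Nat.cast_one, one_mul]; nlinarith [Real.exp_pos (-(ε * Rσ))]
  · show 8 * μ * ((1 : ℕ) * B6.c0 1 η ^ dm) * R₁ ≤ μ * R
    rw [Nat.cast_one, one_mul]; nlinarith

end Family

end Literature.MathematicalPhysics.QuantumFieldTheory.Balaban1983to89.NodeOLettersOfWalksPerturbativeWitness

end
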